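import Summits.CriticalPhenomena.PercolationContinuityZ3.Theorems.PercGamblersRuinBGNOffTheFloorStructure
import HarnessLib

/-!
# `BGNOffTheFloor` (stmt-CriticalPhenomena-7773) — the ladder step from plane gluing

Crux `Summit.CriticalPhenomena.PercolationContinuityZ3.Theses.PercGamblersRuin.BGNOffTheFloor`
(route `PercGamblersRuin`, item stmt-CriticalPhenomena-7773), line `registered` (birth skeleton
`Cruxes/BGNOffTheFloor/Lines/birth.lean`, lead c3 reshape). Support lemma (`--supports`), θ-blind, proved.

Notation of the docstrings: `E(A, L) = {ω | ∃ y, y₀ = L ∧ ω ∈ {0 ⟷ y in {z | -A < z₀}}}` (the CLIMB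
EVENT), `e_n(a,b) = P_{p_c}(E(a n, b n))`, `f(A, L) = P_{p_c}(E(A, L))`,
`OffFloorAt a b :≡ liminf_n e_n(a,b) = 0`; the crux is `∀ a < b, OffFloorAt a b`.

**PLANE GLUING** (registered stub `stub_planeGluing` of the reshaped skeleton — OPEN; it is the
instance `G = {z₀ > -a n}`, `A =` the plane `{z₀ = b n}`, `B =` the plane `{z₀ = (b+1) n}` of the
"post-FKG" correlation inequality `P(0 ⟷ B) ≥ P(0 ⟷ A) · min_{y ∈ A} P(y ⟷ B)` conjectured by
Kozma–Nitzan, arXiv:2401.12397, Conjecture 1, in its infinite-volume form; by horizontal and vertical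
translation invariance `min_{y ∈ A} P(y ⟷ B in G) = f((a+b) n, n)`):
`e_n(a,b) · f((a+b) n, n) ≤ e_n(a,b+1)` for `1 ≤ a < b`, `n ≥ 1`.

* `OffFloor.climbExtension_of_planeGluing` (= registered glue stub
  `stub_climbExtensionOfPlaneGluing`) — **plane gluing implies the ladder step** `ClimbExtension`
  (`1 ≤ a < b`: `OffFloorAt a (b+1) → OffFloorAt a b`) θ-BLINDLY: if `θ(p_c) = 0` every pair is off
  the floor outright (`OffFloor.offFloor_of_theta_eq_zero`); if `θ(p_c) > 0` the gluing factor is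
  bounded below at every scale, `f((a+b) n, n) ≥ f(n, n) ≥ θ(p_c)/2` (floor monotonicity
  `OffFloor.climb_real_mono` and the diagonal bound `OffFloor.theta_le_two_mul_climb_diag`), so
  `e_n(a,b) ≤ (2/θ(p_c)) · e_n(a,b+1)` and `liminf` transfers.

So the ladder step of the crux is reduced to ONE instance family of a published correlation-inequality
conjecture (which Kozma–Nitzan prove for `|A| = 2` and for `0` adjacent to `A`, and support
numerically; the full conjecture implies `θ(p_c) = 0` in every `d ≥ 2`, loc. cit. §4).

References: G. Kozma, S. Nitzan, *A reduction of the θ(p_c) = 0 problem to a conjectured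
inequality*, arXiv:2401.12397 (2024), Conjecture 1 and §4; G. Grimmett, *Percolation*, 2nd ed.
(1999), Thm. (7.35).
-/

noncomputable section

namespace Summit.CriticalPhenomena.PercolationContinuityZ3.Theorems

open MeasureTheory Filter Literature.Probability.Percolation Literature.Probability.LatticeModels
open scoped Topology

namespace OffFloor

/-- **Plane gluing implies the ladder step, θ-blindly.** If for all `1 ≤ a < b`, `n ≥ 1`,
`e_n(a,b) · f((a+b) n, n) ≤ e_n(a,b+1)` (plane gluing), then for `1 ≤ a < b`,
`liminf_n e_n(a,b+1) = 0 → liminf_n e_n(a,b) = 0`. Cases: `θ(p_c) = 0` gives the conclusion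
outright (`offFloor_of_theta_eq_zero`); `θ(p_c) > 0` gives `f((a+b) n, n) ≥ f(n,n) ≥ θ(p_c)/2`
(`climb_real_mono`, `theta_le_two_mul_climb_diag`), hence `e_n(a,b) ≤ (2/θ) e_n(a,b+1)`. [folklore] -/
theorem climbExtension_of_planeGluing
    (hplane : ∀ a b n : ℕ, 1 ≤ a → a < b → 1 ≤ n →
      (bondPercolation (zdGraph 3) (criticalProbI 3)).real
          {ω | ∃ y : Site 3, y 0 = ((b * n : ℕ) : ℤ) ∧
            ω ∈ openConnIn {z : Site 3 | -((a * n : ℕ) : ℤ) < z 0} 0 y} *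
        (bondPercolation (zdGraph 3) (criticalProbI 3)).real
          {ω | ∃ y : Site 3, y 0 = ((n : ℕ) : ℤ) ∧
            ω ∈ openConnIn {z : Site 3 | -(((a + b) * n : ℕ) : ℤ) < z 0} 0 y} ≤
      (bondPercolation (zdGraph 3) (criticalProbI 3)).real
          {ω | ∃ y : Site 3, y 0 = (((b + 1) * n : ℕ) : ℤ) ∧
            ω ∈ openConnIn {z : Site 3 | -((a * n : ℕ) : ℤ) < z 0} 0 y}) :
    ∀ a b : ℕ, 1 ≤ a → a < b →
      (∀ ε : ℝ, 0 < ε → ∃ᶠ n : ℕ in atTop,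
        (bondPercolation (zdGraph 3) (criticalProbI 3)).real
            {ω | ∃ y : Site 3, y 0 = (((b + 1) * n : ℕ) : ℤ) ∧
              ω ∈ openConnIn {z : Site 3 | -((a * n : ℕ) : ℤ) < z 0} 0 y} < ε) →
      ∀ ε : ℝ, 0 < ε → ∃ᶠ n : ℕ in atTop,
        (bondPercolation (zdGraph 3) (criticalProbI 3)).real
            {ω | ∃ y : Site 3, y 0 = ((b * n : ℕ) : ℤ) ∧
              ω ∈ openConnIn {z : Site 3 | -((a * n : ℕ) : ℤ) < z 0} 0 y} < ε := by
  intro a b ha hab hhyp ε hε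
  by_cases hθ : theta (zdGraph 3) 0 (criticalProbI 3) = 0
  · exact offFloor_of_theta_eq_zero hθ a b (by omega) ε hε
  · set θ := theta (zdGraph 3) 0 (criticalProbI 3) with hθdef
    have hθpos : 0 < θ := lt_of_le_of_ne measureReal_nonneg (Ne.symm hθ)
    refine ((hhyp (ε * θ / 2) (by positivity)).and_eventually (eventually_ge_atTop 1)).mono ?_
    rintro n ⟨hn, hn1⟩
    have hpl := hplane a b n ha hab hn1
    have hdiag := theta_le_two_mul_climb_diag n hn1
    have hmono : (bondPercolation (zdGraph 3) (criticalProbI 3)).real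
          {ω | ∃ y : Site 3, y 0 = (n : ℤ) ∧ ω ∈ openConnIn {z : Site 3 | -(n : ℤ) < z 0} 0 y} ≤
        (bondPercolation (zdGraph 3) (criticalProbI 3)).real
          {ω | ∃ y : Site 3, y 0 = ((n : ℕ) : ℤ) ∧
            ω ∈ openConnIn {z : Site 3 | -(((a + b) * n : ℕ) : ℤ) < z 0} 0 y} := by
      refine climb_real_mono (criticalProbI 3) (A := (n : ℤ)) (A' := (((a + b) * n : ℕ) : ℤ))
        (L := (n : ℤ)) (L' := (n : ℤ)) ?_ (by positivity) le_rfl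
      have : n ≤ (a + b) * n := Nat.le_mul_of_pos_left n (by omega)
      exact_mod_cast this
    -- abbreviate the three probabilities
    set X := (bondPercolation (zdGraph 3) (criticalProbI 3)).real
        {ω | ∃ y : Site 3, y 0 = ((b * n : ℕ) : ℤ) ∧
          ω ∈ openConnIn {z : Site 3 | -((a * n : ℕ) : ℤ) < z 0} 0 y} with hX
    set Y := (bondPercolation (zdGraph 3) (criticalProbI 3)).real
        {ω | ∃ y : Site 3, y 0 = ((n : ℕ) : ℤ) ∧
          ω ∈ openConnIn {z : Site 3 | -(((a + b) * n : ℕ) : ℤ) < z 0} 0 y} with hY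
    set Z := (bondPercolation (zdGraph 3) (criticalProbI 3)).real
        {ω | ∃ y : Site 3, y 0 = (((b + 1) * n : ℕ) : ℤ) ∧
          ω ∈ openConnIn {z : Site 3 | -((a * n : ℕ) : ℤ) < z 0} 0 y} with hZ
    have hYge : θ / 2 ≤ Y := by linarith
    have hY0 : 0 < Y := by linarith
    have hXY : X * Y < ε * Y := by
      calc X * Y ≤ Z := hpl
        _ < ε * θ / 2 := hn
        _ = ε * (θ / 2) := by ring
        _ ≤ ε * Y := mul_le_mul_of_nonneg_left hYge hε.le
    exact lt_of_mul_lt_mul_right hXY hY0.le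

end OffFloor

/-- **Glue stub `stub_climbExtensionOfPlaneGluing` of line `registered` (birth) of
`BGNOffTheFloor`, registered signature verbatim (lead c3 reshape).** Plane gluing (registered stub
`stub_planeGluing`, the Kozma–Nitzan post-FKG inequality for the planes `{z₀ = b n}`, `{z₀ = (b+1) n}`
in `{z₀ > -a n}`) implies the ladder step `ClimbExtension` (`1 ≤ a < b`:
`liminf_n e_n(a,b+1) = 0 → liminf_n e_n(a,b) = 0`), θ-blindly
(`OffFloor.climbExtension_of_planeGluing`). [folklore] -/
theorem stub_climbExtensionOfPlaneGluing :
    (∀ a b n : ℕ, 1 ≤ a → a < b → 1 ≤ n →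
      (bondPercolation (zdGraph 3) (criticalProbI 3)).real
          {ω | ∃ y : Site 3, y 0 = ((b * n : ℕ) : ℤ) ∧
            ω ∈ openConnIn {z : Site 3 | -((a * n : ℕ) : ℤ) < z 0} 0 y} *
        (bondPercolation (zdGraph 3) (criticalProbI 3)).real
          {ω | ∃ y : Site 3, y 0 = ((n : ℕ) : ℤ) ∧
            ω ∈ openConnIn {z : Site 3 | -(((a + b) * n : ℕ) : ℤ) < z 0} 0 y} ≤
      (bondPercolation (zdGraph 3) (criticalProbI 3)).real
          {ω | ∃ y : Site 3, y 0 = (((b + 1) * n : ℕ) : ℤ) ∧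
            ω ∈ openConnIn {z : Site 3 | -((a * n : ℕ) : ℤ) < z 0} 0 y}) →
    ∀ a b : ℕ, 1 ≤ a → a < b →
      (∀ ε : ℝ, 0 < ε → ∃ᶠ n : ℕ in atTop,
        (bondPercolation (zdGraph 3) (criticalProbI 3)).real
            {ω | ∃ y : Site 3, y 0 = (((b + 1) * n : ℕ) : ℤ) ∧
              ω ∈ openConnIn {z : Site 3 | -((a * n : ℕ) : ℤ) < z 0} 0 y} < ε) →
      ∀ ε : ℝ, 0 < ε → ∃ᶠ n : ℕ in atTop,
        (bondPercolation (zdGraph 3) (criticalProbI 3)).real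
            {ω | ∃ y : Site 3, y 0 = ((b * n : ℕ) : ℤ) ∧
              ω ∈ openConnIn {z : Site 3 | -((a * n : ℕ) : ℤ) < z 0} 0 y} < ε :=
  fun hplane => OffFloor.climbExtension_of_planeGluing hplane

end Summit.CriticalPhenomena.PercolationContinuityZ3.Theorems

end
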